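import Summits.QuantumFields.YangMills.Theorems.BalabanUVNodesK2JsOfRecord

/-! # CRIT-2 g3 — LAST-ENTRY BLINDNESS collapses every last-entry-currency modulus letter to BOX-CONSTANCY (k ≥ 1)

Context: IDEA-1 g12 F-E ∕ CRIT-1 g5 S.1953 (located; second-read by CRIT-2 against [I] p.255 (0.19) and p.256 (0.22)): in the TREE's
free-history effective action `Node00.BackgroundActionT.effActionHT … g = printedSeq (T K) (χ K g) (gfOfRecord F N K) g 1`
(`B12Eq019ActionBody.printedSeq_succ` :417, `nextAction` :142–144, `integrand χ GF gk A := χ·exp(−(1/gk²)·GF + A)` :115–116) the history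
entry `g k` (k ≥ 1) enters step k → k+1 ONLY through the gauge-fixing prefactor and the normalising constant, while print (0.22) p.256
RE-IMPOSES the main term `A_k(g_k, V) = −(1/g_k²) A(U_k(V)) + E_k(U_k(V))` at a free `g_k`.  Modulo exact Faddeev–Popov independence of the
gauge-fixing strength ((0.15)–(0.16) p.255, «the integrand does not depend on u»; NOT constructible in the tree — hypothesis `H` below is its
SHAPE on a history-indexed β, never asserted of any record), the tree's β over free histories is BLIND to its last entry from k = 1 on.

CLAIM (kernel, generic, elementary): a last-entry-blind β admitting ANY last-entry-currency modulus on a history box — `BoxModulus`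
(idea-5 Sketch3 :404, VERBATIM copy below), hence `LinOnBox` (Sketch3 :445, via its `boxModulus_of_linOnBox`), and the tree's linear
`K2JsOfRecord.BoxRemainder` (:210) — is CONSTANT `= b k` on the whole box at every scale k ≥ 1.  So at a record β these letters are, modulo H,
the (2.13)-EXACT history-independence on boxes — absurd strength, not a «modulus».  RUN-currency letters (`RunModulus`, 1ᶜᴿ, Rʳ rows) and
BOX-SIZE letters (`ScaleAnchor`, `ConstRemainder`) are NOT of this shape and are not touched.  Nothing of Bałaban asserted; no record β named. -/

open Filter Topology
open Literature.MathematicalPhysics.QuantumFieldTheory.Balaban1983to89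
open Literature.MathematicalPhysics.QuantumFieldTheory.Balaban1983to89.FlowStep
open Literature.MathematicalPhysics.QuantumFieldTheory.Balaban1983to89.B12Beta (HistBox)
open Summit.QuantumFields.YangMills.Theorems.BalabanUVNodesK2JsOfRecord (BoxRemainder)

namespace Crit2LastEntryBlind

/-- VERBATIM copy of idea-5 Sketch3's `BoxModulus` (`Idea5g10CornerModulusRoadSketch3.lean` :404; crux workfiles are not importable). [folklore] -/
def BoxModulus (β : HBeta) (b : ℕ → ℝ) (γ₀ : ℝ) : Prop :=
  ∃ ω : ℝ → ℝ, Tendsto ω (𝓝[>] 0) (𝓝 0) ∧ ∀ (k : ℕ) (p : Fin (k + 1) → ℝ), p ∈ HistBox γ₀ k → |β k p - b k| ≤ ω (p (Fin.last k))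

/-- HYPOTHESIS SHAPE `H` — LAST-ENTRY BLINDNESS from scale 1 on: `β k` does not read `p (Fin.last k)` (`k ≥ 1`).  The shape exact FP-independence of the
gauge-fixing strength would give the TREE's free-history β; never asserted of any record. [folklore] -/
def LastEntryBlindFrom1 (β : HBeta) : Prop :=
  ∀ k : ℕ, 1 ≤ k → ∀ (p : Fin (k + 1) → ℝ) (t : ℝ), 0 < t → β k p = β k (Function.update p (Fin.last k) t)

/-- Updating the last entry of a box point by `t ∈ ]0, γ₀]` stays in the box. [folklore] -/
theorem update_mem_histBox {γ₀ : ℝ} {k : ℕ} {p : Fin (k + 1) → ℝ} (hp : p ∈ HistBox γ₀ k) {t : ℝ} (ht : 0 < t) (htγ : t ≤ γ₀) :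
    Function.update p (Fin.last k) t ∈ HistBox γ₀ k := by
  intro i
  by_cases hi : i = Fin.last k
  · subst hi; simp [ht, htγ]
  · simp [Function.update_of_ne hi, (hp i).1, (hp i).2]

/-- **★ BLINDNESS + BOX MODULUS ⟹ BOX-CONSTANCY (k ≥ 1)**: if `β` is last-entry blind from scale 1 and carries a box modulus towards `b` on `]0, γ₀]`
(`γ₀ > 0`), then `β k p = b k` for EVERY box point `p`, every `k ≥ 1`. [folklore] -/
theorem boxConst_of_blind_boxModulus {β : HBeta} {b : ℕ → ℝ} {γ₀ : ℝ} (hγ : 0 < γ₀)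
    (hB : LastEntryBlindFrom1 β) (hM : BoxModulus β b γ₀) :
    ∀ k : ℕ, 1 ≤ k → ∀ p ∈ HistBox γ₀ k, β k p = b k := by
  intro k hk p hp
  obtain ⟨ω, hω, hmod⟩ := hM
  -- |β k p − b k| ≤ ω t for every t ∈ ]0, γ₀], and ω t → 0 as t → 0⁺
  have key : ∀ t : ℝ, 0 < t → t ≤ γ₀ → |β k p - b k| ≤ ω t := by
    intro t ht htγ
    have h := hmod k (Function.update p (Fin.last k) t) (update_mem_histBox hp ht htγ)
    rw [← hB k hk p t ht] at h
    simpa using h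
  by_contra hne
  have hpos : 0 < |β k p - b k| := abs_pos.mpr (sub_ne_zero.mpr hne)
  -- ω is eventually (< |β k p − b k|) within ]0, ∞[ near 0; pick such a t that is also ≤ γ₀
  have hev : ∀ᶠ t in 𝓝[>] (0 : ℝ), ω t < |β k p - b k| :=
    (hω.eventually (gt_mem_nhds hpos))
  have hev' : ∀ᶠ t in 𝓝[>] (0 : ℝ), t ≤ γ₀ ∧ 0 < t := by
    have h1 : ∀ᶠ t in 𝓝[>] (0 : ℝ), t ≤ γ₀ :=
      mem_nhdsWithin_of_mem_nhds (Iic_mem_nhds hγ)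
    have h2 : ∀ᶠ t in 𝓝[>] (0 : ℝ), 0 < t := self_mem_nhdsWithin
    exact h1.and h2
  obtain ⟨t, ht1, ht2, ht3⟩ := (hev.and hev').exists
  exact absurd (key t ht3 ht2) (not_le.mpr ht1)

/-- **COROLLARY for the tree's LINEAR letter**: last-entry blindness + `K2JsOfRecord.BoxRemainder β b Cr γ₀` (`|β k p − b k| ≤ Cr·p_last`, (2.13) in AF-1 form)
⟹ box-constancy at every `k ≥ 1`. [folklore] -/
theorem boxConst_of_blind_boxRemainder {β : HBeta} {b : ℕ → ℝ} {Cr γ₀ : ℝ} (hγ : 0 < γ₀)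
    (hB : LastEntryBlindFrom1 β) (hR : BoxRemainder β b Cr γ₀) :
    ∀ k : ℕ, 1 ≤ k → ∀ p ∈ HistBox γ₀ k, β k p = b k := by
  refine boxConst_of_blind_boxModulus hγ hB ⟨fun t => |Cr| * |t|, ?_, fun k p hp => ?_⟩
  · have : Tendsto (fun t : ℝ => |Cr| * |t|) (𝓝 0) (𝓝 (|Cr| * |0|)) :=
      (continuous_const.mul continuous_abs).tendsto 0
    simpa using this.mono_left nhdsWithin_le_nhds
  · calc |β k p - b k| ≤ Cr * p (Fin.last k) := hR k p hp
      _ ≤ |Cr * p (Fin.last k)| := le_abs_self _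
      _ = |Cr| * |p (Fin.last k)| := abs_mul _ _

/-- **CONVERSELY the collapse is sharp**: a box-constant-from-1 β that is ALSO constant at k = 0 carries the box modulus with ω ≡ 0 — so modulo blindness the
last-entry modulus letters are EQUIVALENT to box-constancy (k ≥ 1) plus whatever they say at k = 0. [folklore] -/
theorem boxModulus_of_boxConst {β : HBeta} {b : ℕ → ℝ} {γ₀ : ℝ}
    (h : ∀ k : ℕ, ∀ p ∈ HistBox γ₀ k, β k p = b k) : BoxModulus β b γ₀ :=
  ⟨fun _ => 0, tendsto_const_nhds, fun k p hp => by simp [h k p hp]⟩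

/-- NON-VACUITY of `H` with a genuinely history-dependent β (reads the FIRST entry only): `β k p := p 0`. It is last-entry blind from 1, and it carries NO box
modulus towards any `b` on any `]0, γ₀]` (γ₀ > 0) — by the ★ theorem it would have to be constant in `p 0`. [folklore] -/
theorem firstEntry_blind_noBoxModulus {γ₀ : ℝ} (hγ : 0 < γ₀) (b : ℕ → ℝ) :
    LastEntryBlindFrom1 (fun _ p => p 0) ∧ ¬ BoxModulus (fun _ p => p 0) b γ₀ := by
  refine ⟨fun k hk p t _ => ?_, fun hM => ?_⟩
  · have h0 : (0 : Fin (k + 1)) ≠ Fin.last k := by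
      intro h; have := congrArg Fin.val h; simp at this; omega
    simp [Function.update_of_ne h0]
  · have hc := boxConst_of_blind_boxModulus hγ (fun k hk p t _ => by
      have h0 : (0 : Fin (k + 1)) ≠ Fin.last k := by
        intro h; have := congrArg Fin.val h; simp at this; omega
      simp [Function.update_of_ne h0]) hM 1 le_rfl
    -- two box points at k = 1 with different first entries
    have hp : (fun i : Fin 2 => if i = 0 then γ₀ else γ₀) ∈ HistBox γ₀ 1 := fun i => by
      by_cases hi : i = 0 <;> simp [hi, hγ]
    have hq : (fun i : Fin 2 => if i = 0 then γ₀ / 2 else γ₀) ∈ HistBox γ₀ 1 := fun i => by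
      by_cases hi : i = 0 <;> simp [hi, hγ, half_pos hγ, half_le_self hγ.le]
    have h1 := hc _ hp
    have h2 := hc _ hq
    simp at h1 h2
    linarith

end Crit2LastEntryBlind
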